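import Summits.QuantumFields.YangMills.Theorems.BalabanUVNodesN19RateEdgeHolderD4AtCoreLedgerReading
import Summits.QuantumFields.YangMills.Theorems.BalabanUVNodesN19RateEdgeHolderD4AtTrimmedLedgerReadingV

/-!
# BalabanUVNodes ∕ N19 — THE CORE LEDGER READING AT THE WITNESS READING `crOfRecord₁₃VAt K₀ (jc …) sh` (V edition): NODE O's N19′ link reading with node N11's idle (iii) block OUT
# (g5 FILE 3 `…AtCoreLedgerReading`) at K3 «v6»'s witness spine reading, (ii-m)'s reference ledger ON THE FAMILY's LATTICES (the four lattice clauses and `0 ≤ S.vol` DEFINITIONAL, the binders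
# `Pf d₀ L₀` out) — THE SMALLEST DISPLAYED NODE-O OBLIGATION OF THIS LINEAGE at the reading stub 2 instantiates (versus v9 at this reading: 74 conjuncts ∕ 27 binders out; ≈45-line binder);
# N19′'s edge there — per tuple, under the `ForSmallCouplings` prefix (mirror-free), and as K3 «v6»'s (B)-free face in dag-n27-c's finite-volume currency

Cell `pub-ymgap`, HUMAN RULING D-0062 (Track A), WIDTH SEAT `pub-ymgap-dag-n19-w3` (N19 NE7, seat 3 of 3), generation g5; bus INTENT-4.  Cluster item **K3⁸ «SpineGivenEndpointR13SepCoPHV»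
(stmt-QuantumFields-27366)**, skeleton K3 «v6» b4e55110ab73e679 (stub 2's witness reading `PinnedAtLive jc sh cr`: `cr = crOfRecord₁₃V (jc …) sh = crOfRecord₁₃VAt 0 (jc …) sh`; untouched).
Filed `--kind proof --supports stmt-QuantumFields-27366 --as helper` (proves no registered stub).  COUNT-NEUTRAL.  THEOREMS ONLY; 0 `def`; 0 `sorry`; `N`-generic, `K₀`-generic, guard-generic
`G`; NO Theses ∕ NO mirror import.  Imports this seat's `…AtCoreLedgerReading` (g5 FILE 3: the located removal of N11's block + the (B)-free bill at the core reading; transitively g5 FILE 1 p636214 and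
`…AtSqueezedLedgerReading` p631491) and `…AtTrimmedLedgerReadingV` (g4, p628905: dag-n20-d's `crOfRecord₁₃VAt` p590105, dag-n19-d's `latticeLetters_family`) — CITED BY NAME, none edited.

WHAT THIS FILE PROVES (`S := crOfRecord₁₃VAt K₀ (jc F θ hP g₀ os) sh F θ hP g₀ os`, `R := rateCarriersOfRecord₁₃CoPH 𝔯 F θ hP g₀ os k`, `D := datumOfRecord₁₃CoPH F N θ hP`; section hypothesis
`hlinkCoreV` = g5 FILE 2's `hlinkSqzV` minus N11's block = FILE 3's `hlinkCore` at `S` minus the lattice clauses, `0 ≤ S.vol` and the binders `Pf d₀ L₀`).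
(`hlinkCoreV` is carried EXPLICITLY in each theorem's signature — `dedup.landed` does not see section hypotheses.)
SECOND LOCATED POINT (V reading only): the κ-THRESHOLD ROW `kappa₀ (4·2⁴) (2·4) ≤ R.u3.κ` of the reading (B12 ∕ [Dimock2013] tree-decay threshold for the reference ledger's
`Multiplicity`; `kappa₀ 64 8 = 64 · log 162 ≈ 325.6`) mentions NO ∃-bound variable at the witness reading and, under the (t-U3) pin, IS the LETTER inequality `kappa₀ 64 8 ≤ (ℓ F θ).κ`
on stub 1's U3 letter reading (`(u3OfRecord₁₃ … ℓ k).κ = ℓ.κ`, `rfl`, dag-n19-w5 `kappa_eq_letter`): NOT NODE O's obligation — it LEAVES `hlinkCoreV` and is DISPLAYED as `hκ₀` next to the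
U3 letter rows.  K3 «v6»'s `GuardedReadingN16` ∕ stub 1's rows (`Signs`, `0 < κ`, `betaPrime510 4 1 κ ≤ cr`) do NOT carry it ⇒ located input for the v7 precut's U3 letter list.
* §1 ★★ `linkReadingAtCoreLedgerReading_crOfRecord₁₃VAt_of_linkReadingAtCoreLedgerReadingV` — `hlinkCoreV` + the (t-U3) pin + `hκ₀` ⇒ FILE 3's `hlinkCore` text at `cr := fun F θ hP g₀ os ↦ S`
  VERBATIM (`Pf := fun K ↦ F.P (Koff + K)`, `d₀ := 4`, `L₀ := F.L`; lattice clauses by `latticeLetters_family F Koff`, `0 ≤ S.vol = F.side ^ 4` by `T4Family.side_pos`; the κ row from `hκ₀`).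
* §2 ★★★ `keyedCoreEdgeHolderD4BFree_crOfRecord₁₃VAt_of_linkReadingAtCoreLedgerReadingV_finiteVolumeRows` — K3 «v6»'s (B)-free N19′ face SPELLED at `cr := fun … ↦ S` in dag-n27-c's
  finite-volume currency (FILE 3 §2 at §1's reading): THE N19′-SIDE BILL OF K3⁸ AT ITS WITNESS READING AFTER g5 — the three pins · `hmatch hend` · `hs hr hinc h9` · `hβw` · `hWall` ·
  `hradii ∧ hclass` · `2∕3 < β ≤ 1` · `hlinkCoreV`.
The `ForSmallCouplings`-prefix supplier and the per-tuple `_tuned` form at this reading are the sibling `…AtCoreLedgerReadingVFSC` (g5 FILE 4b).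

HONEST FRAMING.  Count-neutral kernel bookkeeping — compositions of LANDED lemmas, ZERO estimate content; `hlinkCoreV` (NODE O's world; 0 instances), `hradii`∕`hclass`, `hdecT` ∕ stub 1's rows,
the pins, v5∕v6's N16 rows, `D.Tuned` (K2⁷), the β-window (K1⁷) are HYPOTHESES; `K₀ jc sh 𝔯 G ℓ ℓ₃ g B c' ks` PARAMETERS (`sh` NOT inhabited; the cut `jc` free — plan's v6 BOOKING (5)
stands; `(0, sh_rec)` specialises by `rfl`).  NOT a proof of any stub or of K3⁸; nothing of Bałaban's asserted or instantiated (K0⁷ OPEN); NE7 NOT PRINTED ∕ NOT proved; N11 NOT READ; N14 ∕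
N16 ∕ N18 ∕ N19 ∕ N22 NOT discharged; K3⁸ OPEN, NOT claimed; counts unmoved (typed 28∕28 · discharged 5∕27 · A 5∕28).  One finite four-torus at fixed ε — R4 closes the CONDITIONAL finite-𝕋⁴
rung `BalabanLadder.UV` only; NOT infinite volume ∕ OS ∕ mass gap; the YM mass gap (Clay) is NOT proved by any of this.  Standard axioms.  Edits nothing.
-/

set_option autoImplicit false

noncomputable section

open Finset MeasureTheory
open scoped BigOperators Matrix Matrix.Norms.L2Operator

namespace Summit.QuantumFields.YangMills.BalabanUVNodes.N19RateEdgeHolderD4AtCoreLedgerReadingV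

open Literature.MathematicalPhysics.QuantumFieldTheory.Balaban1983to89
open T4OutputRate T4RecentScale T4GoodClassBudget T4CauchySum T4TowerRateComposition T4TowerRateDischarge
open T4EtaRateMin (Readings NE3Shape)
open T4RateLiaison (GaugeDominated)
open FlowStep (RGEqH prefixOf)
open TreeLengthTorus (TFaceConnected torusTreeLen)
open B12TreeDecay (kappa₀)
open Summit.QuantumFields.BalabanUV.T4Continuum
open AveragingDeficitDualResidual (dualC1 dualC2)
open AveragingDeficitDerivWallProof (wallConst)
open AveragingDeficitPeriodicCounting (IsPeriodicDir)
open MinimalActionSandwich (IsMinimiser minAct)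
open MinimalActionRate (sfClass)
open MinimalActionRefine (RegularSup gradConst)
open NE3EnergyShapes (IsUnitarySite IsPeriodicSite)
open NE3.LeafIndexSockets (LeafH3sup)
open Summit.QuantumFields.BalabanUV.T4Continuum.Spine
open Summit.QuantumFields.BalabanUV.T4Continuum.Spine.NE4 (runFlow)
open Summit.QuantumFields.BalabanUV.T4Continuum.NE1p.DressedRoot (DressedTower DressedStabilityStrict)
open Summit.QuantumFields.YangMills.BalabanUVNodes.N19LedgerLinkSync (LedgerDataSync LedgerAtSync)
open YMDAG.UVSplit (SpineCarriers SpineRecordPred InputsPred U3Carriers RateCarriers RateRecordPred N14At N18At N22At ReadOutAt)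
open Summit.QuantumFields.YangMills.BalabanUVNodes.N16HolderDefs (CovRootHolder N16HolderAt)
open Summit.QuantumFields.YangMills.BalabanUVNodes.SpineRatesHolder (RatesHolderAt)
open Literature.MathematicalPhysics.QuantumFieldTheory.Balaban1983to89.T4Continuum (T4Family ULoop)
open YMDAG.UVSplit (Datum RateReading₁₃CoPH rateCarriersOfRecord₁₃CoPH ne3OfRecord₁₁)
open Node00 (Stage13HParams datumOfRecord₁₃CoPH SiteSeqKey NE3Letters₁₁ ne3ConstLayerOfRecord₁₁ ne3NperOfRecord₁₁ ne3DomOfRecord₁₁)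
open Summit.QuantumFields.YangMills.BalabanUVNodes.N16PinnedLayer13CoPH (N16PinnedLoose N16LettersEnd rateCarriers_ne3_of_pinnedLoose)
open YMDAG.N14.TopBorn (ne1OfRecord obsSupNorm Ne1PinnedOfRecord)
open Node00 (U3Letters₁₁)
open Literature.MathematicalPhysics.QuantumFieldTheory.Balaban1983to89.Node00.U3OfKernels (objectsOfRecord₁₃)
open Literature.MathematicalPhysics.QuantumFieldTheory.Balaban1983to89.Node00.U3KernelLetters (PolLimitsExistOfRecord₁₃ WindowedNE9OfRecord₁₃ WindowedDecayOfRecord₁₃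
  GeometricIncrementsOfRecord₁₃)
open T4ContinuumYM4Torus (ForSmallCouplings)
open Summit.QuantumFields.YangMills.BalabanUVNodes.N19LinkReadingAtU3Pin (u3_rateCarriersOfRecord₁₃CoPH_of_pin)
open YMDAG.UVSplit (ShellSplit₁₃CoPH crOfRecord₁₃VAt)
open Summit.QuantumFields.YangMills.BalabanUVNodes.N19RateEdgeRecordRunLetters (latticeLetters_family)
open Summit.QuantumFields.YangMills.BalabanUVNodes.N19RateEdgeHolderD4AtCoreLedgerReading (keyedCoreEdgeHolderD4BFree_of_linkReadingAtCoreLedgerReading_finiteVolumeRows)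

variable {N : ℕ} [NeZero N]

section AtCoreLedgerReadingV

variable (K₀ : ℕ)
  (jc : (F : T4Family) → (θ : Stage13HParams F N) → θ.Provisos₁₃CoPH F N → (ℕ → ℝ) → List (ULoop F) → ℕ → ℕ) (sh : ShellSplit₁₃CoPH N K₀)
  (𝔯 : RateReading₁₃CoPH N) (G : ∀ {F : T4Family}, Stage13HParams F N → Prop) {β : ℝ} (hβ1 : β ≤ 1)
  {ℓ₃ : T4Family → NE3Letters₁₁} {g B c' : T4Family → ℝ}

/-! ## §1 The core ledger reading at the V reading IS FILE 3's core ledger reading at `cr := crOfRecord₁₃VAt K₀ (jc …) sh` -/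

/-- ★★ **THE CORE LEDGER READING AT THE V READING YIELDS THE SIBLING's CORE LEDGER READING AT `cr := crOfRecord₁₃VAt K₀ (jc …) sh`** [bookkeeping ∕ located]: `hlinkCoreV`, the (t-U3)
pin `hpinκ` and the LETTER row `hκ₀ : kappa₀ 64 8 ≤ (ℓκ F θ).κ` yield FILE 3's `hlinkCore` text VERBATIM at that `cr`: `Pf := fun K => F.P (Koff + K)`, `d₀ := 4`, `L₀ := F.L`, the four
lattice clauses by dag-n19-d's `latticeLetters_family F Koff` (`S.vol = F.side ^ 4` is `rfl`), `0 ≤ S.vol` by `T4Family.side_pos`, the κ-threshold row `kappa₀ (4·2⁴) (2·4) ≤ R.u3.κ` from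
`hκ₀` (the pinned bundle's `κ` IS the letter's — dag-n19-w5 `u3_rateCarriersOfRecord₁₃CoPH_of_pin`, `rfl`); everything else passed through.  So at the witness reading the κ-threshold is a
condition on stub 1's U3 letter reading, NOT NODE O's obligation.  Both readings are HYPOTHESES (0 instances); N19 NOT discharged. -/
theorem linkReadingAtCoreLedgerReading_crOfRecord₁₃VAt_of_linkReadingAtCoreLedgerReadingV
    (hlinkCoreV : ∀ (F : T4Family) (θ : Stage13HParams F N) (hP : θ.Provisos₁₃CoPH F N), G θ → θ.Admissible F N →
    ∀ (γ gIR b : ℝ) (g₀ : ℕ → ℝ), (datumOfRecord₁₃CoPH F N θ hP).Tuned γ gIR g₀ → γ ≤ θ.γ → γ ^ 2 ≤ Real.exp (-1) → 0 < b →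
    (∀ K m, 0 ≤ m → m < K → b ≤ (datumOfRecord₁₃CoPH F N θ hP).βfun m (prefixOf (runFlow (datumOfRecord₁₃CoPH F N θ hP) g₀ K) m)) →
    ∀ (os : List (ULoop F)) (k : ℕ),
      let S : SpineCarriers := crOfRecord₁₃VAt K₀ (jc F θ hP g₀ os) sh F θ hP g₀ os
      let R : RateCarriers N := rateCarriersOfRecord₁₃CoPH 𝔯 F θ hP g₀ os k
      let D : Datum F N := datumOfRecord₁₃CoPH F N θ hP
      letI := S.dec
      ∃ (_ : DecidableEq R.u3.C.Dom) (F' : Type) (ι' X' : Type) (_ : MeasurableSpace ι')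
        (L : LedgerDataSync R.u3.C F' ι' S.ι) (Rd : Readings ι' X') (bsel : (ℕ → ℝ) → ℝ) (EB : Functional R.u3.C R.u3.C.BgB)
        (g : ℕ → ℕ → ℝ)
        (uA : ℕ → ι' → R.u3.C.BgA) (uB : ℕ → ι' → R.u3.C.BgB)
        (Koff : ℕ) (cells : (K j : ℕ) → R.u3.C.Dom → Finset (Site (F.P (Koff + K)) j))
        (θ : ℝ)
        (sel : ℕ → (B7Prop1Explicit.Site 4 → Fin 4 → (Matrix (Fin N) (Fin N) ℂ)ˣ) → (B7Prop1Explicit.Site 4 → Fin 4 → (Matrix (Fin N) (Fin N) ℂ)ˣ))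
        (rd : ι' → (B7Prop1Explicit.Site 4 → Fin 4 → (Matrix (Fin N) (Fin N) ℂ)ˣ)),
        (∀ K i, i ≤ K → g K i = runFlow D g₀ K i) ∧ (∀ K i, K < i → g K i = gIR) ∧
        EB = (fun s => R.u3.EB (bsel s) s) ∧
        (∀ (Sz : ℕ → ℝ → S.ι → ℕ → ℝ) (E₀ : ℝ) (m : ℕ) (a : ℝ) (Cw Λg : ℝ),
          (∀ K t, |t| ≤ S.l₀ → ∀ τ ∈ S.T K \ S.Bad K t, ∀ v ∈ Rd.dom, ∀ j ≤ K,
            |∑ X ∈ L.fac K t τ with R.u3.C.scale X = j,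
                (Real.log (Real.exp (EB (fun i => g (K + 1) (i + 1)) (uB K v) X
                    - EB (fun i => g (K + 1) (i + 1)) L.oneB X))
                  - Real.log (Real.exp (R.u3.EA (g K) (uA K v) X - R.u3.EA (g K) L.oneA X)))| ≤ Sz K t τ j) →
          0 ≤ E₀ → 0 < a → a < 1 →
          (∀ K t, |t| ≤ S.l₀ → ∀ τ ∈ S.T K \ S.Bad K t, ∀ j ≤ K,
            Sz K t τ j ≤ S.vol * (E₀ * ((K : ℝ) + 1) ^ m * a ^ (K - j))) →
          (∀ K, Multiplicity (L.All K) R.u3.C.scale (fun X => Real.exp (-(R.u3.κ * R.u3.C.d X))) Cw S.vol Λg K) →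
          (∀ K t, |t| ≤ S.l₀ → ∀ τ ∈ S.T K \ S.Bad K t,
            WindowMultiplicity (L.facO K t τ) L.scO L.wO Cw S.vol Λg (jlogOf L.Cl K) K) →
          1 ≤ Λg → L.θ' ≤ Λg →
          LedgerAtSync { L with S := Sz, E₀ := E₀, m := m, a := a, Cw := Cw, Λg := Λg } S.l₀ S.vol S.T S.Bad
            (fun K t τ => S.A K t τ - S.shA K t τ) (fun K t τ => S.B K t τ - S.shB K t τ) Rd R.u3.EA EB R.u3.κ g uA uB
            R.u3.ω R.u3.ρ R.u3.θ (θ ^ ((3 : ℝ) * β - 2))) ∧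
        (∀ K t, |t| ≤ S.l₀ → ∀ τ ∈ S.T K \ S.Bad K t,
          WindowMultiplicity (L.facO K t τ) L.scO L.wO L.Cw S.vol L.Λg (jlogOf L.Cl K) K) ∧
        0 ≤ L.Cw ∧ 1 ≤ L.Λg ∧ L.θ' ≤ L.Λg ∧
        (∀ K, ∀ X ∈ L.All K,
          (cells K (R.u3.C.scale X + Koff) X).Nonempty ∧ TFaceConnected (cells K (R.u3.C.scale X + Koff) X)) ∧
        (∀ K j, Set.InjOn (cells K j) ↑((L.All K).filter fun X => R.u3.C.scale X + Koff = j)) ∧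
        (∀ K, ∀ X ∈ L.All K, torusTreeLen (cells K (R.u3.C.scale X + Koff) X) ≤ R.u3.C.d X) ∧
        LeafH3sup 4 R.ne3.L R.ne3.Nper R.ne3.ε R.ne3.b (c' F) R.ne3.dom ∧
        (∀ V ∈ R.ne3.dom, ∀ k : ℕ, IsMinimiser 4 (sfClass 4 R.ne3.L R.ne3.Nper R.ne3.ε) R.ne3.L R.ne3.Nper k V (sel k V)) ∧
        (∀ V ∈ R.ne3.dom, ∀ k : ℕ, RegularSup 4 R.ne3.L R.ne3.Nper R.ne3.b (c' F) k (sel k V)) ∧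
        0 < θ ∧ θ ^ 6 = ((R.ne3.L : ℝ))⁻¹ ∧
        (∀ v ∈ Rd.dom, rd v ∈ R.ne3.dom) ∧
        (∀ k, ∀ v ∈ Rd.dom, Rd.act k v = minAct 4 (sfClass 4 R.ne3.L R.ne3.Nper R.ne3.ε) R.ne3.L R.ne3.Nper k (rd v)) ∧
        (R.ne3.Nper : ℝ) ^ 4 ≤ Rd.vol ∧
        (∀ s ∈ Window γ, 0 < bsel s ∧ bsel s ≤ γ))
    (ℓκ : (F : T4Family) → Stage13HParams F N → U3Letters₁₁)
    (hpinκ : ∀ (F : T4Family) (θ : Stage13HParams F N) (hP : θ.Provisos₁₃CoPH F N) (g₀ : ℕ → ℝ) (os : List (ULoop F)),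
      (𝔯.lit F θ hP g₀ os).u3 = objectsOfRecord₁₃ F N θ.toStage13Params (ℓκ F θ))
    (hκ₀ : ∀ (F : T4Family) (θ : Stage13HParams F N), θ.Provisos₁₃CoPH F N → G θ → θ.Admissible F N → kappa₀ (4 * 2 ^ 4) (2 * 4) ≤ (ℓκ F θ).κ) :
    ∀ (F : T4Family) (θ : Stage13HParams F N) (hP : θ.Provisos₁₃CoPH F N), G θ → θ.Admissible F N →
    ∀ (γ gIR b : ℝ) (g₀ : ℕ → ℝ), (datumOfRecord₁₃CoPH F N θ hP).Tuned γ gIR g₀ → γ ≤ θ.γ → γ ^ 2 ≤ Real.exp (-1) → 0 < b →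
    (∀ K m, 0 ≤ m → m < K → b ≤ (datumOfRecord₁₃CoPH F N θ hP).βfun m (prefixOf (runFlow (datumOfRecord₁₃CoPH F N θ hP) g₀ K) m)) →
    ∀ (os : List (ULoop F)) (k : ℕ),
      let S : SpineCarriers := crOfRecord₁₃VAt K₀ (jc F θ hP g₀ os) sh F θ hP g₀ os
      let R : RateCarriers N := rateCarriersOfRecord₁₃CoPH 𝔯 F θ hP g₀ os k
      let D : Datum F N := datumOfRecord₁₃CoPH F N θ hP
      letI := S.dec
      ∃ (_ : DecidableEq R.u3.C.Dom) (F' : Type) (ι' X' : Type) (_ : MeasurableSpace ι')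
        (L : LedgerDataSync R.u3.C F' ι' S.ι) (Rd : Readings ι' X') (bsel : (ℕ → ℝ) → ℝ) (EB : Functional R.u3.C R.u3.C.BgB)
        (g : ℕ → ℕ → ℝ)
        (uA : ℕ → ι' → R.u3.C.BgA) (uB : ℕ → ι' → R.u3.C.BgB)
        (Pf : ℕ → Params) (d₀ L₀ Koff : ℕ) (cells : (K j : ℕ) → R.u3.C.Dom → Finset (Site (Pf K) j))
        (θ : ℝ)
        (sel : ℕ → (B7Prop1Explicit.Site 4 → Fin 4 → (Matrix (Fin N) (Fin N) ℂ)ˣ) → (B7Prop1Explicit.Site 4 → Fin 4 → (Matrix (Fin N) (Fin N) ℂ)ˣ))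
        (rd : ι' → (B7Prop1Explicit.Site 4 → Fin 4 → (Matrix (Fin N) (Fin N) ℂ)ˣ)),
        (∀ K i, i ≤ K → g K i = runFlow D g₀ K i) ∧ (∀ K i, K < i → g K i = gIR) ∧
        EB = (fun s => R.u3.EB (bsel s) s) ∧
        (∀ (Sz : ℕ → ℝ → S.ι → ℕ → ℝ) (E₀ : ℝ) (m : ℕ) (a : ℝ) (Cw Λg : ℝ),
          (∀ K t, |t| ≤ S.l₀ → ∀ τ ∈ S.T K \ S.Bad K t, ∀ v ∈ Rd.dom, ∀ j ≤ K,
            |∑ X ∈ L.fac K t τ with R.u3.C.scale X = j,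
                (Real.log (Real.exp (EB (fun i => g (K + 1) (i + 1)) (uB K v) X
                    - EB (fun i => g (K + 1) (i + 1)) L.oneB X))
                  - Real.log (Real.exp (R.u3.EA (g K) (uA K v) X - R.u3.EA (g K) L.oneA X)))| ≤ Sz K t τ j) →
          0 ≤ E₀ → 0 < a → a < 1 →
          (∀ K t, |t| ≤ S.l₀ → ∀ τ ∈ S.T K \ S.Bad K t, ∀ j ≤ K,
            Sz K t τ j ≤ S.vol * (E₀ * ((K : ℝ) + 1) ^ m * a ^ (K - j))) →
          (∀ K, Multiplicity (L.All K) R.u3.C.scale (fun X => Real.exp (-(R.u3.κ * R.u3.C.d X))) Cw S.vol Λg K) →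
          (∀ K t, |t| ≤ S.l₀ → ∀ τ ∈ S.T K \ S.Bad K t,
            WindowMultiplicity (L.facO K t τ) L.scO L.wO Cw S.vol Λg (jlogOf L.Cl K) K) →
          1 ≤ Λg → L.θ' ≤ Λg →
          LedgerAtSync { L with S := Sz, E₀ := E₀, m := m, a := a, Cw := Cw, Λg := Λg } S.l₀ S.vol S.T S.Bad
            (fun K t τ => S.A K t τ - S.shA K t τ) (fun K t τ => S.B K t τ - S.shB K t τ) Rd R.u3.EA EB R.u3.κ g uA uB
            R.u3.ω R.u3.ρ R.u3.θ (θ ^ ((3 : ℝ) * β - 2))) ∧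
        0 ≤ S.vol ∧
        (∀ K t, |t| ≤ S.l₀ → ∀ τ ∈ S.T K \ S.Bad K t,
          WindowMultiplicity (L.facO K t τ) L.scO L.wO L.Cw S.vol L.Λg (jlogOf L.Cl K) K) ∧
        0 ≤ L.Cw ∧ 1 ≤ L.Λg ∧ L.θ' ≤ L.Λg ∧
        (∀ K, (Pf K).d = d₀) ∧ (∀ K, (Pf K).L = L₀) ∧ (∀ K, (Pf K).K = Koff + K) ∧
        (∀ K, (Fintype.card (Site (Pf K) (Pf K).K) : ℝ) = S.vol) ∧
        kappa₀ (4 * 2 ^ d₀) (2 * d₀) ≤ R.u3.κ ∧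
        (∀ K, ∀ X ∈ L.All K,
          (cells K (R.u3.C.scale X + Koff) X).Nonempty ∧ TFaceConnected (cells K (R.u3.C.scale X + Koff) X)) ∧
        (∀ K j, Set.InjOn (cells K j) ↑((L.All K).filter fun X => R.u3.C.scale X + Koff = j)) ∧
        (∀ K, ∀ X ∈ L.All K, torusTreeLen (cells K (R.u3.C.scale X + Koff) X) ≤ R.u3.C.d X) ∧
        LeafH3sup 4 R.ne3.L R.ne3.Nper R.ne3.ε R.ne3.b (c' F) R.ne3.dom ∧
        (∀ V ∈ R.ne3.dom, ∀ k : ℕ, IsMinimiser 4 (sfClass 4 R.ne3.L R.ne3.Nper R.ne3.ε) R.ne3.L R.ne3.Nper k V (sel k V)) ∧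
        (∀ V ∈ R.ne3.dom, ∀ k : ℕ, RegularSup 4 R.ne3.L R.ne3.Nper R.ne3.b (c' F) k (sel k V)) ∧
        0 < θ ∧ θ ^ 6 = ((R.ne3.L : ℝ))⁻¹ ∧
        (∀ v ∈ Rd.dom, rd v ∈ R.ne3.dom) ∧
        (∀ k, ∀ v ∈ Rd.dom, Rd.act k v = minAct 4 (sfClass 4 R.ne3.L R.ne3.Nper R.ne3.ε) R.ne3.L R.ne3.Nper k (rd v)) ∧
        (R.ne3.Nper : ℝ) ^ 4 ≤ Rd.vol ∧
        (∀ s ∈ Window γ, 0 < bsel s ∧ bsel s ≤ γ) := by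
  intro F θ hP hG hθ γ gIR b g₀ ht hγle hγe hb0 hlow os k
  obtain ⟨iDom, F', ι', X', iMeas, L, Rd, bsel, EB, gr, uA, uB, hrest⟩ := hlinkCoreV F θ hP hG hθ γ gIR b g₀ ht hγle hγe hb0 hlow os k
  obtain ⟨Koff, cells, ϑ, sel, rd, hrest⟩ := hrest
  obtain ⟨hgle, hggt, hEB, hL, homult, hCw, hΛg, hθΛ, hdom, hinj, hlen, hrest⟩ := hrest
  obtain ⟨hPd, hPL, hPK, hcard⟩ := latticeLetters_family F Koff
  have hvol : (0 : ℝ) ≤ (crOfRecord₁₃VAt K₀ (jc F θ hP g₀ os) sh F θ hP g₀ os).vol := pow_nonneg F.side_pos.le 4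
  -- the κ-threshold row is, under the (t-U3) pin, the LETTER inequality `kappa₀ 64 8 ≤ (ℓκ F θ).κ` (the pinned bundle's `κ` is the letter's, `rfl`)
  have hκrow : kappa₀ (4 * 2 ^ 4) (2 * 4) ≤ (rateCarriersOfRecord₁₃CoPH 𝔯 F θ hP g₀ os k).u3.κ := by
    rw [u3_rateCarriersOfRecord₁₃CoPH_of_pin 𝔯 θ hP g₀ os (ℓκ F θ) (hpinκ F θ hP g₀ os) k]
    exact hκ₀ F θ hP hG hθ
  exact ⟨iDom, F', ι', X', iMeas, L, Rd, bsel, EB, gr, uA, uB, fun K => F.P (Koff + K), 4, F.L, Koff, cells, ϑ, sel, rd,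
    hgle, hggt, hEB, hL, hvol, homult, hCw, hΛg, hθΛ, hPd, hPL, hPK, hcard, hκrow, hdom, hinj, hlen, hrest⟩

/-! ## §2 K3 «v6»'s (B)-free N19′ face at the V reading in dag-n27-c's finite-volume currency, core ledger reading (FILE 3 §2 at §1's reading) -/

include hβ1 in
/-- ★★★ **K3 «v6»'s (B)-FREE N19′ FACE, SPELLED, AT THE WITNESS READING `crOfRecord₁₃VAt K₀ (jc …) sh`, CORE LEDGER READING, FINITE-VOLUME CURRENCY** [bookkeeping]: for every
`F θ hP` with `G θ`, `θ.Admissible F N`: `ForSmallCouplings D (fun g₀ => ∀ os, (RatesHolderAt D R β ∧ ReadOutAt D R.u3 ∧ (0 ≤ ρ ∧ ρ < 1)) → ∃ δ, NE7.Core S … δ ∧ Summable δ)` at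
`R := rateCarriersOfRecord₁₃CoPH 𝔯 F θ hP g₀ os (ks …)` (dag-n27-w1's `K3V6Defs.KeyedCoreEdgeHolderD4BFree β cr (rrOfRecord 𝔯 ks)` at `cr := fun … ↦ S`, unfolded) — THE N19′-SIDE BILL OF
K3⁸ AT ITS WITNESS READING AFTER g5: the three pins · `hmatch hend` · stub 1's rows `hs hr hinc h9` · the U3 letter row `hκ₀ : kappa₀ 64 8 ≤ (ℓ F θ).κ` («κ large», ≈ 325.6) · K1⁷'s
window `hβw` · `hWall` (W1's (5.10) letter at all 16 pairs) · node N16's key-level letters `hradii ∧ hclass` · `2∕3 < β ≤ 1` · NODE O's core reading `hlinkCoreV` (≈44-line binder; N11's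
block, the lattice rows and the κ-threshold row gone).  ONE FACE-SHAPE of `stub_expansion13HV` at its witness
reading modulo displayed hypotheses — NOT the stub, NOT K3⁸; N11 NOT READ; N14 ∕ N16 ∕ N18 ∕ N19 ∕ N22 NOT discharged. -/
theorem keyedCoreEdgeHolderD4BFree_crOfRecord₁₃VAt_of_linkReadingAtCoreLedgerReadingV_finiteVolumeRows
    (hlinkCoreV : ∀ (F : T4Family) (θ : Stage13HParams F N) (hP : θ.Provisos₁₃CoPH F N), G θ → θ.Admissible F N →
    ∀ (γ gIR b : ℝ) (g₀ : ℕ → ℝ), (datumOfRecord₁₃CoPH F N θ hP).Tuned γ gIR g₀ → γ ≤ θ.γ → γ ^ 2 ≤ Real.exp (-1) → 0 < b →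
    (∀ K m, 0 ≤ m → m < K → b ≤ (datumOfRecord₁₃CoPH F N θ hP).βfun m (prefixOf (runFlow (datumOfRecord₁₃CoPH F N θ hP) g₀ K) m)) →
    ∀ (os : List (ULoop F)) (k : ℕ),
      let S : SpineCarriers := crOfRecord₁₃VAt K₀ (jc F θ hP g₀ os) sh F θ hP g₀ os
      let R : RateCarriers N := rateCarriersOfRecord₁₃CoPH 𝔯 F θ hP g₀ os k
      let D : Datum F N := datumOfRecord₁₃CoPH F N θ hP
      letI := S.dec
      ∃ (_ : DecidableEq R.u3.C.Dom) (F' : Type) (ι' X' : Type) (_ : MeasurableSpace ι')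
        (L : LedgerDataSync R.u3.C F' ι' S.ι) (Rd : Readings ι' X') (bsel : (ℕ → ℝ) → ℝ) (EB : Functional R.u3.C R.u3.C.BgB)
        (g : ℕ → ℕ → ℝ)
        (uA : ℕ → ι' → R.u3.C.BgA) (uB : ℕ → ι' → R.u3.C.BgB)
        (Koff : ℕ) (cells : (K j : ℕ) → R.u3.C.Dom → Finset (Site (F.P (Koff + K)) j))
        (θ : ℝ)
        (sel : ℕ → (B7Prop1Explicit.Site 4 → Fin 4 → (Matrix (Fin N) (Fin N) ℂ)ˣ) → (B7Prop1Explicit.Site 4 → Fin 4 → (Matrix (Fin N) (Fin N) ℂ)ˣ))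
        (rd : ι' → (B7Prop1Explicit.Site 4 → Fin 4 → (Matrix (Fin N) (Fin N) ℂ)ˣ)),
        (∀ K i, i ≤ K → g K i = runFlow D g₀ K i) ∧ (∀ K i, K < i → g K i = gIR) ∧
        EB = (fun s => R.u3.EB (bsel s) s) ∧
        (∀ (Sz : ℕ → ℝ → S.ι → ℕ → ℝ) (E₀ : ℝ) (m : ℕ) (a : ℝ) (Cw Λg : ℝ),
          (∀ K t, |t| ≤ S.l₀ → ∀ τ ∈ S.T K \ S.Bad K t, ∀ v ∈ Rd.dom, ∀ j ≤ K,
            |∑ X ∈ L.fac K t τ with R.u3.C.scale X = j,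
                (Real.log (Real.exp (EB (fun i => g (K + 1) (i + 1)) (uB K v) X
                    - EB (fun i => g (K + 1) (i + 1)) L.oneB X))
                  - Real.log (Real.exp (R.u3.EA (g K) (uA K v) X - R.u3.EA (g K) L.oneA X)))| ≤ Sz K t τ j) →
          0 ≤ E₀ → 0 < a → a < 1 →
          (∀ K t, |t| ≤ S.l₀ → ∀ τ ∈ S.T K \ S.Bad K t, ∀ j ≤ K,
            Sz K t τ j ≤ S.vol * (E₀ * ((K : ℝ) + 1) ^ m * a ^ (K - j))) →
          (∀ K, Multiplicity (L.All K) R.u3.C.scale (fun X => Real.exp (-(R.u3.κ * R.u3.C.d X))) Cw S.vol Λg K) →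
          (∀ K t, |t| ≤ S.l₀ → ∀ τ ∈ S.T K \ S.Bad K t,
            WindowMultiplicity (L.facO K t τ) L.scO L.wO Cw S.vol Λg (jlogOf L.Cl K) K) →
          1 ≤ Λg → L.θ' ≤ Λg →
          LedgerAtSync { L with S := Sz, E₀ := E₀, m := m, a := a, Cw := Cw, Λg := Λg } S.l₀ S.vol S.T S.Bad
            (fun K t τ => S.A K t τ - S.shA K t τ) (fun K t τ => S.B K t τ - S.shB K t τ) Rd R.u3.EA EB R.u3.κ g uA uB
            R.u3.ω R.u3.ρ R.u3.θ (θ ^ ((3 : ℝ) * β - 2))) ∧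
        (∀ K t, |t| ≤ S.l₀ → ∀ τ ∈ S.T K \ S.Bad K t,
          WindowMultiplicity (L.facO K t τ) L.scO L.wO L.Cw S.vol L.Λg (jlogOf L.Cl K) K) ∧
        0 ≤ L.Cw ∧ 1 ≤ L.Λg ∧ L.θ' ≤ L.Λg ∧
        (∀ K, ∀ X ∈ L.All K,
          (cells K (R.u3.C.scale X + Koff) X).Nonempty ∧ TFaceConnected (cells K (R.u3.C.scale X + Koff) X)) ∧
        (∀ K j, Set.InjOn (cells K j) ↑((L.All K).filter fun X => R.u3.C.scale X + Koff = j)) ∧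
        (∀ K, ∀ X ∈ L.All K, torusTreeLen (cells K (R.u3.C.scale X + Koff) X) ≤ R.u3.C.d X) ∧
        LeafH3sup 4 R.ne3.L R.ne3.Nper R.ne3.ε R.ne3.b (c' F) R.ne3.dom ∧
        (∀ V ∈ R.ne3.dom, ∀ k : ℕ, IsMinimiser 4 (sfClass 4 R.ne3.L R.ne3.Nper R.ne3.ε) R.ne3.L R.ne3.Nper k V (sel k V)) ∧
        (∀ V ∈ R.ne3.dom, ∀ k : ℕ, RegularSup 4 R.ne3.L R.ne3.Nper R.ne3.b (c' F) k (sel k V)) ∧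
        0 < θ ∧ θ ^ 6 = ((R.ne3.L : ℝ))⁻¹ ∧
        (∀ v ∈ Rd.dom, rd v ∈ R.ne3.dom) ∧
        (∀ k, ∀ v ∈ Rd.dom, Rd.act k v = minAct 4 (sfClass 4 R.ne3.L R.ne3.Nper R.ne3.ε) R.ne3.L R.ne3.Nper k (rd v)) ∧
        (R.ne3.Nper : ℝ) ^ 4 ≤ Rd.vol ∧
        (∀ s ∈ Window γ, 0 < bsel s ∧ bsel s ≤ γ)) (hβ23 : 2 / 3 < β) (hpin1 : Ne1PinnedOfRecord 𝔯)
    (ℓ : (F : T4Family) → Stage13HParams F N → U3Letters₁₁)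
    (hpinU3 : ∀ (F : T4Family) (θ : Stage13HParams F N) (hP : θ.Provisos₁₃CoPH F N) (g₀ : ℕ → ℝ) (os : List (ULoop F)),
      (𝔯.lit F θ hP g₀ os).u3 = objectsOfRecord₁₃ F N θ.toStage13Params (ℓ F θ))
    (hκ₀ : ∀ (F : T4Family) (θ : Stage13HParams F N), θ.Provisos₁₃CoPH F N → G θ → θ.Admissible F N → kappa₀ (4 * 2 ^ 4) (2 * 4) ≤ (ℓ F θ).κ)
    (hpinL : N16PinnedLoose 𝔯 ℓ₃ B) (hmatch : ∀ F : T4Family, 0 < B F ∧ (ℓ₃ F).ε / B F ≤ (ℓ₃ F).b) (hend : N16LettersEnd N g ℓ₃)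
    (hradii : ∀ F : T4Family, (ℓ₃ F).g = gradConst 4 (c' F) ∧ 0 ≤ c' F ∧ 0 < c' F ∧ (ℓ₃ F).b ≤ c' F ∧
      (2 : ℝ) ^ 91 * (F.L : ℝ) ^ 17 * c' F ≤ 1 ∧ (2 : ℝ) ^ 76 * (F.L : ℝ) ^ 12 * c' F ≤ (ℓ₃ F).ε ∧ (ℓ₃ F).ε / B F ≤ 1 / 4 ∧ 4 * ((ℓ₃ F).ε / B F) ≤ c' F)
    (hclass : ∀ F : T4Family, 16 * B7Prop2Explicit.C0 4 * (ℓ₃ F).ε ≤ 3 ∧ 1024 * (4 + 1) * (4 + 4) * (F.L : ℝ) ^ 2 * (ℓ₃ F).ε ≤ 1)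
    (hs : ∀ (F : T4Family) (θ : Stage13HParams F N), θ.Provisos₁₃CoPH F N → G θ → θ.Admissible F N → (ℓ F θ).Signs)
    (r : (F : T4Family) → Stage13HParams F N → ℝ)
    (hr : ∀ (F : T4Family) (θ : Stage13HParams F N), θ.Provisos₁₃CoPH F N → G θ → θ.Admissible F N → r F θ < 1)
    (hinc : ∀ (F : T4Family) (θ : Stage13HParams F N), θ.Provisos₁₃CoPH F N → G θ → θ.Admissible F N →
      GeometricIncrementsOfRecord₁₃ F N θ.toStage13Params (r F θ))
    (h9 : ∀ (F : T4Family) (θ : Stage13HParams F N), θ.Provisos₁₃CoPH F N → G θ → θ.Admissible F N →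
      WindowedNE9OfRecord₁₃ F N θ.toStage13Params (ℓ F θ).κ (ℓ F θ).moduli)
    (hWall : ∀ (μ ν : Fin 4) (F : T4Family) (θ : Stage13HParams F N), θ.Provisos₁₃CoPH F N → G θ → θ.Admissible F N →
      WindowedDecayOfRecord₁₃ F N θ.toStage13Params μ ν (ℓ F θ).κ)
    (ks : (F : T4Family) → (θ : Stage13HParams F N) → θ.Provisos₁₃CoPH F N → (ℕ → ℝ) → List (ULoop F) → ℕ)
    (hβw : ∀ (F : T4Family) (θ : Stage13HParams F N) (hP : θ.Provisos₁₃CoPH F N), G θ → θ.Admissible F N →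
      ∃ γ₀ b b' : ℝ, 0 < γ₀ ∧ 0 < b ∧ DagBinding.BetaBoundsInInterval (datumOfRecord₁₃CoPH F N θ hP).C.toB12 γ₀ b b') :
    ∀ (F : T4Family) (θ : Stage13HParams F N) (hP : θ.Provisos₁₃CoPH F N), G θ → θ.Admissible F N →
      ForSmallCouplings (datumOfRecord₁₃CoPH F N θ hP) fun g₀ => ∀ os : List (ULoop F),
        (RatesHolderAt (datumOfRecord₁₃CoPH F N θ hP) (rateCarriersOfRecord₁₃CoPH 𝔯 F θ hP g₀ os (ks F θ hP g₀ os)) β ∧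
          ReadOutAt (datumOfRecord₁₃CoPH F N θ hP) (rateCarriersOfRecord₁₃CoPH 𝔯 F θ hP g₀ os (ks F θ hP g₀ os)).u3 ∧
          (0 ≤ (rateCarriersOfRecord₁₃CoPH 𝔯 F θ hP g₀ os (ks F θ hP g₀ os)).u3.ρ ∧ (rateCarriersOfRecord₁₃CoPH 𝔯 F θ hP g₀ os (ks F θ hP g₀ os)).u3.ρ < 1)) →
        letI := (crOfRecord₁₃VAt K₀ (jc F θ hP g₀ os) sh F θ hP g₀ os).dec
        ∃ δ : ℕ → ℝ, NE7.Core (crOfRecord₁₃VAt K₀ (jc F θ hP g₀ os) sh F θ hP g₀ os).l₀ (crOfRecord₁₃VAt K₀ (jc F θ hP g₀ os) sh F θ hP g₀ os).vol (crOfRecord₁₃VAt K₀ (jc F θ hP g₀ os) sh F θ hP g₀ os).T (crOfRecord₁₃VAt K₀ (jc F θ hP g₀ os) sh F θ hP g₀ os).Bad (fun K t τ => (crOfRecord₁₃VAt K₀ (jc F θ hP g₀ os) sh F θ hP g₀ os).A K t τ - (crOfRecord₁₃VAt K₀ (jc F θ hP g₀ os) sh F θ hP g₀ os).shA K t τ)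 (fun K t τ => (crOfRecord₁₃VAt K₀ (jc F θ hP g₀ os) sh F θ hP g₀ os).B K t τ - (crOfRecord₁₃VAt K₀ (jc F θ hP g₀ os) sh F θ hP g₀ os).shB K t τ) δ ∧ Summable δ :=
  keyedCoreEdgeHolderD4BFree_of_linkReadingAtCoreLedgerReading_finiteVolumeRows (fun F θ hP g₀ os => crOfRecord₁₃VAt K₀ (jc F θ hP g₀ os) sh F θ hP g₀ os) 𝔯 G hβ1
    (linkReadingAtCoreLedgerReading_crOfRecord₁₃VAt_of_linkReadingAtCoreLedgerReadingV K₀ jc sh 𝔯 G hlinkCoreV ℓ hpinU3 hκ₀) hβ23 hpin1 ℓ hpinU3 hpinL hmatch hend hradii hclass hs r hr hinc h9 hWall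
    ks hβw

end AtCoreLedgerReadingV
end Summit.QuantumFields.YangMills.BalabanUVNodes.N19RateEdgeHolderD4AtCoreLedgerReadingV
end
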